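import Summits.HodgeConjecture.HodgeConjecture.Theorems.K2E3QuasiSplitUnitaryCartanAnyInvolutionStep   -- part I (this seat): `exists_pivot_row`, `exists_conj_eigen_of_pivot`, `hermForm`∕`J₀` tools
import Literature.NumberTheory.Automorphic.HyperspecialUnitarySatakeIsomorphism                        -- ★ `swapPairs`, `flipPair` (rev-commuting pair permutations)
import HarnessLib

/-!
# Cartan decomposition of the quasi-split unitary group `U(σ, J₀)(K)` for ANY isometric involution `σ` — II: `U(σ, J₀) = K₀ · {diag(d) : σ(d_i) d_{rev i} = 1} · K₀`
# (crux H413, U12-g ∕ 13a road A, item (W); Tits 1979 §3.3.3, Bruhat–Tits 1972 (4.4.3))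

Cell `hodgecm-mathlib`, Track B «K2-LIT», crux item `stmt-HodgeConjecture-24833` (h413), line `K2_E3_EllipticInputs`, row 13a `sig_K2E3LocalIrrepAdmissible`; seat K2E3-p09 (g3).
THEOREMS ONLY — no `def`, no named fact, no instance, no notation, no `sorry`; count-neutral helper (`--supports stmt-HodgeConjecture-24833 --as helper`).

**`exists_cartan_antidiagonal (hσ) (hvσ) (g) (hg)`** — for every field `K` with a valuation `v : K → ℤᵐ⁰`, every involution `σ` with `v ∘ σ = v`, every `g ∈ U(σ, J₀)(K)`:
`k₁ g k₂ = diag(d)` with `k₁, k₂ ∈ U(σ, J₀)` INTEGRAL WITH INTEGRAL INVERSES and `σ(d_i) · d_{rev i} = 1` — the statement of ★ p856347 `exists_cartan_antidiagonal_of_trace_norm`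
(K2E3-p23) with `(hϖ) (htrace) (hnorm)` DELETED (no uniformiser, no (trace)∕(norm), no `2 ≠ 0`: the WILDLY RAMIFIED quadratic extensions, both parities of `N`, are covered).
§1 `exists_perm_rev_apply_eq`: a `rev`-commuting permutation with `0 ↦ s` for `s ≠ rev s` (★ `swapPairs`, ★ `flipPair`; their matrices lie in `K₀`, ★ `permGL_mem_unitaryInt`).
§2 an element of `U(σ, J₀)` with `q e₀ = λ e₀`, `q e_{N−1} = μ e_{N−1}` is block diagonal for `(1 ∣ N−2 ∣ 1)` (rows from the columns of `q⁻¹ = J₀σ(q)ᵀJ₀`, ★ `coe_inv_apply_unitary`),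
first block `(λ)`.  §3 **`exists_unitaryInt_mul_mul_eq_diagonalGL`**: strong induction on `N` — integral `g` lies in `K₀`; otherwise a maximal entry of `g` or of `g⁻¹` gives a pivot
`(s, t)`, `s ≠ rev s`, `t ≠ rev t` (part I §2), moved to `(0, 0)` by §1, eliminated by part I §3, the middle block ★ `midBlockU` decomposed by induction, glued by ★
`blockDiagLift hσ _ 1 κ` and rigidity ★ `eq_of_loBlockGL_eq_of_midBlockU_eq` (the `c = 1` case of ★ p856461's gluing); `exists_cartan_antidiagonal` repackages.
Replacing ★ p856347 by it in ★ p856370 ∕ p856461 ∕ p856509 ∕ p856436 ∕ p856532 removes (trace)+(norm): 13a at EVERY quasi-split place (`m ≤ 1`), wild included.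
HONEST LABEL: structure theorem, count-neutral; HC_CM is proved only modulo the 7 printed citations (2 remaining named inputs: hLiu418 = stmt-HodgeConjecture-24832,
h413 = stmt-HodgeConjecture-24833) until rung 0 closes.

## References
* [BruhatTits1972] F. Bruhat, J. Tits, *Groupes réductifs sur un corps local I*, Publ. Math. IHÉS 41 (1972), (4.4.3).
* [Tits1979] J. Tits, *Reductive groups over local fields*, PSPM 33.1 (1979), §3.3.3 (the stabiliser of a self-dual lattice is a special maximal compact subgroup).
* [Macdonald1995] I. G. Macdonald, *Symmetric Functions and Hall Polynomials*, 2nd ed. (1995), Ch. V §2 (elimination with a maximal pivot).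
* [Jacobowitz1962] R. Jacobowitz, *Hermitian forms over local fields*, Amer. J. Math. 84 (1962), §§7–10.
-/

set_option autoImplicit false
-- the mandated namespace repeats `HodgeConjecture.HodgeConjecture`, as in every `Theorems/*.lean` of this sub-problem
set_option linter.dupNamespace false

noncomputable section

open scoped Valued WithZero Matrix MatrixGroups
open Matrix

namespace Summit.HodgeConjecture.HodgeConjecture.Cruxes.H413.K2E3QuasiSplitUnitaryCartanAnyInvolution

open Literature.NumberTheory.Automorphic Literature.NumberTheory.Automorphic.UnitaryGroup Literature.NumberTheory.Automorphic.HermitianLattice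
open K2E3WittLeviCartanBlocks K2E3WittLeviCartanLabels K2E3WittLeviCartanRecursionTame K2E3QuasiSplitUnitaryCartanAnyInvolutionStep

/-! ## §1 Moving the pivot to `(0, 0)` by `rev`-commuting permutations -/

section Perm

variable {N : ℕ}

/-- **A `rev`-commuting permutation with `τ 0 = s`**, for every `s ≠ rev s` (a pair swap ★ `swapPairs`, a pair flip ★ `flipPair`, or their composite).
[cite: BruhatTits1972, (4.4.3)] [cite: Tits1979, §3.3.3] -/
theorem exists_perm_rev_apply_eq (hN : 2 ≤ N) {s : Fin N} (hs : s ≠ Fin.rev s) :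
    ∃ τ : Equiv.Perm (Fin N), (∀ i, τ (Fin.rev i) = Fin.rev (τ i)) ∧ τ ⟨0, by omega⟩ = s := by
  have h0 : ((⟨0, by omega⟩ : Fin N) : ℕ) < N / 2 := by change 0 < N / 2; omega
  have hsv : (s : ℕ) ≠ N - 1 - (s : ℕ) := fun h => hs (Fin.ext (by rw [Fin.val_rev]; omega))
  by_cases hlow : (s : ℕ) < N / 2
  · by_cases h0s : (⟨0, by omega⟩ : Fin N) = s
    · exact ⟨1, fun i => rfl, h0s⟩
    · exact ⟨swapPairs ⟨0, by omega⟩ s, fun i => swapPairs_rev h0s h0 hlow i, swapPairs_apply_left h0s h0 hlow⟩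
  · have hrev : ((Fin.rev s : Fin N) : ℕ) < N / 2 := by rw [Fin.val_rev]; have := s.isLt; omega
    by_cases h0s : (⟨0, by omega⟩ : Fin N) = Fin.rev s
    · refine ⟨flipPair ⟨0, by omega⟩, fun i => flipPair_rev _ i, ?_⟩
      rw [flipPair_apply_self, h0s, Fin.rev_rev]
    · refine ⟨swapPairs ⟨0, by omega⟩ (Fin.rev s) * flipPair ⟨0, by omega⟩, fun i => ?_, ?_⟩
      · rw [Equiv.Perm.mul_apply, Equiv.Perm.mul_apply, flipPair_rev, swapPairs_rev h0s h0 hrev]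
      · rw [Equiv.Perm.mul_apply, flipPair_apply_self, swapPairs_rev h0s h0 hrev, swapPairs_apply_left h0s h0 hrev, Fin.rev_rev]

/-- The inverse of a `rev`-commuting permutation commutes with `rev`. [folklore] -/
theorem perm_inv_rev {τ : Equiv.Perm (Fin N)} (hτ : ∀ i, τ (Fin.rev i) = Fin.rev (τ i)) (i : Fin N) : τ⁻¹ (Fin.rev i) = Fin.rev (τ⁻¹ i) := by
  apply τ.injective
  rw [Equiv.Perm.inv_def, Equiv.apply_symm_apply, hτ, Equiv.apply_symm_apply]

end Perm

/-! ## §2 Block structure of an element with the two extreme eigenvectors -/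

section Block

variable {K : Type*} [Field K] {σ : K →+* K} {N : ℕ}

/-- Entry `(i, j)` from the action on `e_j`: `(q e_j)_i = q_{ij}`. [folklore] -/
theorem apply_eq_of_mulVec_single {q : Matrix (Fin N) (Fin N) K} {j : Fin N} {c : K} {k : Fin N} (h : q *ᵥ Pi.single j 1 = c • Pi.single k 1) (i : Fin N) :
    q i j = c * Pi.single (M := fun _ : Fin N => K) k (1 : K) i := by
  have h' := congrFun h i
  rw [mulVec_single_one_eq] at h'
  dsimp only at h'
  rw [h', Pi.smul_apply, smul_eq_mul]

/-- **An element of `U(σ, J₀)` with `q e₀ = λ e₀` and `q e_{N−1} = μ e_{N−1}` is block UPPER triangular for `(1 ∣ N−2 ∣ 1)`** (`q ∈ Q_1`: the last ROW vanishes off the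
diagonal because the first COLUMN of `q⁻¹ = J₀σ(q)ᵀJ₀` does). [cite: BruhatTits1972, (4.4.3)] -/
theorem mem_blockParabolic_one_of_eigen (hc : 2 * 1 ≤ N) (q : unitaryGroupOfForm σ ((StdForm.antidiagonal N).over K)) {lam : K} (hlam : lam ≠ 0)
    (h0 : ((q : GL (Fin N) K) : Matrix (Fin N) (Fin N) K) *ᵥ Pi.single (⟨0, by omega⟩ : Fin N) 1 = lam • Pi.single (⟨0, by omega⟩ : Fin N) 1) :
    q ∈ blockParabolic σ N 1 := by
  rw [mem_blockParabolic_iff]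
  intro i j hij
  have hi := i.isLt; have hj := j.isLt
  by_cases hj0 : (j : ℕ) < 1
  · have hj0' : j = ⟨0, by omega⟩ := Fin.ext (by change (j : ℕ) = 0; omega)
    have hne : i ≠ ⟨0, by omega⟩ := by
      intro h; rw [h, hj0'] at hij; exact lt_irrefl _ hij
    rw [hj0', apply_eq_of_mulVec_single h0 i, Pi.single_eq_of_ne hne, mul_zero]
  · have hli : blockLabel N 1 i = 2 := by
      have h2 : 1 ≤ blockLabel N 1 j := Nat.one_le_iff_ne_zero.2 fun h => hj0 ((blockLabel_eq_zero_iff j).1 h)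
      have := blockLabel_le_two (c := 1) i; omega
    have hiN : i = Fin.rev ⟨0, by omega⟩ :=
      Fin.ext (by have := (blockLabel_eq_two_iff hc i).1 hli; rw [Fin.val_rev]; change (i : ℕ) = N - (0 + 1); omega)
    have hjN : j ≠ Fin.rev ⟨0, by omega⟩ := by
      intro h
      have : blockLabel N 1 j = 2 := (blockLabel_eq_two_iff hc j).2 (by rw [h, Fin.val_rev]; change N ≤ N - (0 + 1) + 1; omega)
      omega
    have hinv0 : (((q⁻¹ : unitaryGroupOfForm σ ((StdForm.antidiagonal N).over K)) : GL (Fin N) K) : Matrix (Fin N) (Fin N) K) *ᵥ Pi.single (⟨0, by omega⟩ : Fin N) 1 =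
        lam⁻¹ • Pi.single (⟨0, by omega⟩ : Fin N) 1 := by
      have h := congrArg (fun w => (((q⁻¹ : unitaryGroupOfForm σ ((StdForm.antidiagonal N).over K)) : GL (Fin N) K) : Matrix (Fin N) (Fin N) K) *ᵥ w) h0
      simp only at h
      rw [Matrix.mulVec_mulVec, Subgroup.coe_inv, ← Units.val_mul, inv_mul_cancel, Units.val_one, Matrix.one_mulVec, Matrix.mulVec_smul] at h
      rw [Subgroup.coe_inv]
      calc ((((q : GL (Fin N) K)⁻¹ : GL (Fin N) K)) : Matrix (Fin N) (Fin N) K) *ᵥ Pi.single (⟨0, by omega⟩ : Fin N) 1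
          = lam⁻¹ • (lam • (((((q : GL (Fin N) K)⁻¹ : GL (Fin N) K)) : Matrix (Fin N) (Fin N) K) *ᵥ Pi.single (⟨0, by omega⟩ : Fin N) 1)) := by
            rw [smul_smul, inv_mul_cancel₀ hlam, one_smul]
        _ = lam⁻¹ • Pi.single (⟨0, by omega⟩ : Fin N) 1 := by rw [← h]
    have hq := coe_inv_apply_unitary q (Fin.rev j) ⟨0, by omega⟩
    rw [apply_eq_of_mulVec_single hinv0 (Fin.rev j), Pi.single_eq_of_ne (fun h => hjN (by rw [← h, Fin.rev_rev])), mul_zero, Fin.rev_rev] at hq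
    rw [hiN]
    exact σ.injective (by rw [← hq, map_zero])

/-- **… and block LOWER triangular** (the first ROW vanishes off the diagonal because the last COLUMN of `q⁻¹` does). [cite: BruhatTits1972, (4.4.3)] -/
theorem mem_standardParabolicGL_toDual_one_of_eigen (hc : 2 * 1 ≤ N) (q : unitaryGroupOfForm σ ((StdForm.antidiagonal N).over K)) {mu : K} (hmu : mu ≠ 0)
    (hL : ((q : GL (Fin N) K) : Matrix (Fin N) (Fin N) K) *ᵥ Pi.single (Fin.rev (⟨0, by omega⟩ : Fin N)) 1 = mu • Pi.single (Fin.rev (⟨0, by omega⟩ : Fin N)) 1) :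
    (q : GL (Fin N) K) ∈ standardParabolicGL K (OrderDual.toDual ∘ blockLabel N 1) := by
  rw [mem_standardParabolicGL_iff]
  intro i j hij
  have hij' : blockLabel N 1 i < blockLabel N 1 j := hij
  have hi := i.isLt; have hj := j.isLt
  by_cases hjN : blockLabel N 1 j = 2
  · have hjN' : j = Fin.rev ⟨0, by omega⟩ :=
      Fin.ext (by have := (blockLabel_eq_two_iff hc j).1 hjN; rw [Fin.val_rev]; change (j : ℕ) = N - (0 + 1); omega)
    have hne : i ≠ Fin.rev ⟨0, by omega⟩ := by intro h; rw [h, ← hjN'] at hij'; exact lt_irrefl _ hij'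
    rw [hjN', apply_eq_of_mulVec_single hL i, Pi.single_eq_of_ne hne, mul_zero]
  · have hli : blockLabel N 1 i = 0 := by have := blockLabel_le_two (c := 1) j; omega
    have hi0 : i = ⟨0, by omega⟩ := Fin.ext (by have := (blockLabel_eq_zero_iff i).1 hli; change (i : ℕ) = 0; omega)
    have hj0 : j ≠ ⟨0, by omega⟩ := by intro h; rw [h, ← hi0] at hij'; exact lt_irrefl _ hij'
    have hinvL : (((q⁻¹ : unitaryGroupOfForm σ ((StdForm.antidiagonal N).over K)) : GL (Fin N) K) : Matrix (Fin N) (Fin N) K) *ᵥ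
        Pi.single (Fin.rev (⟨0, by omega⟩ : Fin N)) 1 = mu⁻¹ • Pi.single (Fin.rev (⟨0, by omega⟩ : Fin N)) 1 := by
      have h := congrArg (fun w => (((q⁻¹ : unitaryGroupOfForm σ ((StdForm.antidiagonal N).over K)) : GL (Fin N) K) : Matrix (Fin N) (Fin N) K) *ᵥ w) hL
      simp only at h
      rw [Matrix.mulVec_mulVec, Subgroup.coe_inv, ← Units.val_mul, inv_mul_cancel, Units.val_one, Matrix.one_mulVec, Matrix.mulVec_smul] at h
      rw [Subgroup.coe_inv]
      calc ((((q : GL (Fin N) K)⁻¹ : GL (Fin N) K)) : Matrix (Fin N) (Fin N) K) *ᵥ Pi.single (Fin.rev (⟨0, by omega⟩ : Fin N)) 1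
          = mu⁻¹ • (mu • (((((q : GL (Fin N) K)⁻¹ : GL (Fin N) K)) : Matrix (Fin N) (Fin N) K) *ᵥ Pi.single (Fin.rev (⟨0, by omega⟩ : Fin N)) 1)) := by
            rw [smul_smul, inv_mul_cancel₀ hmu, one_smul]
        _ = mu⁻¹ • Pi.single (Fin.rev (⟨0, by omega⟩ : Fin N)) 1 := by rw [← h]
    have hq := coe_inv_apply_unitary q (Fin.rev j) (Fin.rev ⟨0, by omega⟩)
    rw [apply_eq_of_mulVec_single hinvL (Fin.rev j), Pi.single_eq_of_ne (fun h => hj0 (Fin.rev_injective h)), mul_zero, Fin.rev_rev, Fin.rev_rev] at hq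
    rw [hi0]
    exact σ.injective (by rw [← hq, map_zero])

/-- **… with first block `(λ)`**. [cite: BruhatTits1972, (4.4.3)] -/
theorem loBlockGL_eq_of_eigen (hc : 2 * 1 ≤ N) (q : unitaryGroupOfForm σ ((StdForm.antidiagonal N).over K)) (hqP : q ∈ blockParabolic σ N 1) (lam : Kˣ)
    (h0 : ((q : GL (Fin N) K) : Matrix (Fin N) (Fin N) K) *ᵥ Pi.single (⟨0, by omega⟩ : Fin N) 1 = (lam : K) • Pi.single (⟨0, by omega⟩ : Fin N) 1) :
    loBlockGL hc ⟨q, hqP⟩ = diagonalGL (Fin 1) K (fun _ => lam) := by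
  refine Units.ext (Matrix.ext fun i j => ?_)
  have hi : i = 0 := Subsingleton.elim _ _
  have hj : j = 0 := Subsingleton.elim _ _
  subst hi; subst hj
  have hcast : (Fin.castLE (le_of_two_mul_le hc) (0 : Fin 1) : Fin N) = ⟨0, by omega⟩ := Fin.ext rfl
  rw [coe_loBlockGL, loBlock_apply, coe_diagonalGL, Matrix.diagonal_apply_eq, hcast, apply_eq_of_mulVec_single h0, Pi.single_eq_same, mul_one]

end Block

/-! ## §3 The Cartan decomposition, by strong induction on `N` -/

section Main

variable {K : Type*} [Field K] [Valued K ℤᵐ⁰] {σ : K →+* K}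

/-- The identity of `GL_1` is integral. [folklore] -/
theorem v_one_GL_apply_le_one (i j : Fin 1) : Valued.v (((1 : GL (Fin 1) K) : Matrix (Fin 1) (Fin 1) K) i j) ≤ 1 := by
  rw [Units.val_one, Matrix.one_apply]
  split_ifs <;> simp only [map_one, map_zero, le_refl, zero_le_one]

/-- **THE CORE OF THE INDUCTION STEP.**  Given the Cartan decomposition in size `N − 2` (hypothesis `IH`), an element `g ∈ U(σ, J₀)` of size `N` whose entries are
bounded by `M ≠ 0` with `|g_{st}| = M` at a position `s ≠ rev s`, `t ≠ rev t` is `K₀`-bi-equivalent to a diagonal `diag(d)`, `σ(d_i) d_{rev i} = 1`: permute the pivot to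
`(0,0)` (§1), eliminate (part I §3), read off the block structure (§2), decompose the middle block by `IH`, glue by ★ `blockDiagLift` and ★ rigidity.
[cite: BruhatTits1972, (4.4.3)] [cite: Tits1979, §3.3.3] [cite: Macdonald1995, Ch. V §2] -/
theorem exists_unitaryInt_mul_mul_eq_diagonalGL_of_pivot (hσ : ∀ x, σ (σ x) = x) (hvσ : ∀ x, Valued.v (σ x) = Valued.v x) {N : ℕ}
    (IH : ∀ g : unitaryGroupOfForm σ ((StdForm.antidiagonal (N - 2 * 1)).over K),
      ∃ k₁ k₂ : unitaryGroupOfForm σ ((StdForm.antidiagonal (N - 2 * 1)).over K),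
        k₁ ∈ unitaryInt σ ((StdForm.antidiagonal (N - 2 * 1)).over K) ∧ k₂ ∈ unitaryInt σ ((StdForm.antidiagonal (N - 2 * 1)).over K) ∧
        ∃ d : Fin (N - 2 * 1) → Kˣ, (∀ i, σ (d i) * d (Fin.rev i) = 1) ∧
          ((k₁ * g * k₂ : unitaryGroupOfForm σ ((StdForm.antidiagonal (N - 2 * 1)).over K)) : GL (Fin (N - 2 * 1)) K) = diagonalGL (Fin (N - 2 * 1)) K d)
    (g : unitaryGroupOfForm σ ((StdForm.antidiagonal N).over K)) {M : ℤᵐ⁰} (hM0 : M ≠ 0)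
    (hle : ∀ i j, Valued.v (((g : GL (Fin N) K) : Matrix (Fin N) (Fin N) K) i j) ≤ M) {s t : Fin N} (hs : s ≠ Fin.rev s) (ht : t ≠ Fin.rev t)
    (hst : Valued.v (((g : GL (Fin N) K) : Matrix (Fin N) (Fin N) K) s t) = M) :
    ∃ k₁ k₂ : unitaryGroupOfForm σ ((StdForm.antidiagonal N).over K),
      k₁ ∈ unitaryInt σ ((StdForm.antidiagonal N).over K) ∧ k₂ ∈ unitaryInt σ ((StdForm.antidiagonal N).over K) ∧
      ∃ d : Fin N → Kˣ, (∀ i, σ (d i) * d (Fin.rev i) = 1) ∧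
        ((k₁ * g * k₂ : unitaryGroupOfForm σ ((StdForm.antidiagonal N).over K)) : GL (Fin N) K) = diagonalGL (Fin N) K d := by
  have hN2 : 2 ≤ N := by
    have h1 := s.isLt; have h2 : (s : ℕ) ≠ N - 1 - (s : ℕ) := fun h => hs (Fin.ext (by rw [Fin.val_rev]; omega)); omega
  have hc : 2 * 1 ≤ N := by omega
  set i₀ : Fin N := ⟨0, by omega⟩ with hi₀def
  have hi₀ : i₀ ≠ Fin.rev i₀ := by
    intro h; have h' := congrArg Fin.val h; rw [Fin.val_rev] at h'; change 0 = N - (0 + 1) at h'; omega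
  -- §1: move the pivot to `(0, 0)`
  obtain ⟨ρ, hρ, hρ0⟩ := exists_perm_rev_apply_eq hN2 hs
  obtain ⟨τ, hτ, hτ0⟩ := exists_perm_rev_apply_eq hN2 ht
  have hτ' := perm_inv_rev hτ
  set P₁ : unitaryGroupOfForm σ ((StdForm.antidiagonal N).over K) := ⟨permGL ρ, permGL_mem_unitaryGroupOfForm ρ hρ⟩ with hP₁
  set P₂ : unitaryGroupOfForm σ ((StdForm.antidiagonal N).over K) := ⟨permGL τ⁻¹, permGL_mem_unitaryGroupOfForm τ⁻¹ hτ'⟩ with hP₂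
  have hP₁K : P₁ ∈ unitaryInt σ ((StdForm.antidiagonal N).over K) := permGL_mem_unitaryInt ρ hρ
  have hP₂K : P₂ ∈ unitaryInt σ ((StdForm.antidiagonal N).over K) := permGL_mem_unitaryInt τ⁻¹ hτ'
  set g₁ : unitaryGroupOfForm σ ((StdForm.antidiagonal N).over K) := P₁ * g * P₂ with hg₁
  have hg₁entry : ∀ i j, ((g₁ : GL (Fin N) K) : Matrix (Fin N) (Fin N) K) i j = ((g : GL (Fin N) K) : Matrix (Fin N) (Fin N) K) (ρ i) (τ j) := by
    intro i j
    rw [hg₁, Subgroup.coe_mul, Subgroup.coe_mul, Units.val_mul, Units.val_mul]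
    change (((permGL ρ : GL (Fin N) K) : Matrix (Fin N) (Fin N) K) * ((g : GL (Fin N) K) : Matrix (Fin N) (Fin N) K) *
      ((permGL τ⁻¹ : GL (Fin N) K) : Matrix (Fin N) (Fin N) K)) i j = _
    rw [permGL_mul_mul_permGL_apply, Equiv.Perm.inv_def, Equiv.symm_symm]
  have hle₁ : ∀ i j, Valued.v (((g₁ : GL (Fin N) K) : Matrix (Fin N) (Fin N) K) i j) ≤ M := fun i j => by rw [hg₁entry]; exact hle _ _
  have hst₁ : Valued.v (((g₁ : GL (Fin N) K) : Matrix (Fin N) (Fin N) K) i₀ i₀) = M := by rw [hg₁entry, hρ0, hτ0]; exact hst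
  -- part I §3: the elimination step
  obtain ⟨ω₁, ω₂, hω₁, hω₂, hq0, hqL⟩ := exists_conj_eigen_of_pivot hσ hvσ g₁ hM0 hle₁ hi₀ hi₀ hst₁
  set q : unitaryGroupOfForm σ ((StdForm.antidiagonal N).over K) := ω₁⁻¹ * g₁ * ω₂ with hq
  set lam : K := ((g₁ : GL (Fin N) K) : Matrix (Fin N) (Fin N) K) i₀ i₀ with hlam
  have hlam0 : lam ≠ 0 := fun h => hM0 (by rw [← hst₁, h, map_zero])
  have hσlam0 : σ lam ≠ 0 := (map_ne_zero σ).2 hlam0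
  -- §2: block structure of `q`
  have hqP : q ∈ blockParabolic σ N 1 := mem_blockParabolic_one_of_eigen hc q hlam0 hq0
  have hqP' := mem_standardParabolicGL_toDual_one_of_eigen hc q (inv_ne_zero hσlam0) hqL
  set lamu : Kˣ := Units.mk0 lam hlam0 with hlamu
  have hlo : loBlockGL hc ⟨q, hqP⟩ = diagonalGL (Fin 1) K (fun _ => lamu) :=
    loBlockGL_eq_of_eigen hc q hqP lamu (by rw [hlamu, Units.val_mk0]; exact hq0)
  -- the middle block, by induction
  obtain ⟨κ₁, κ₂, hκ₁, hκ₂, d', hd'n, hmid⟩ := IH (midBlockU hc ⟨q, hqP⟩)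
  have hD'U : diagonalGL (Fin (N - 2 * 1)) K d' ∈ unitaryGroupOfForm σ ((StdForm.antidiagonal (N - 2 * 1)).over K) :=
    diagonalGL_mem_unitaryGroupOfForm_of_norm hd'n
  have hmid' : midBlockU hc ⟨q, hqP⟩ = κ₁⁻¹ * ⟨diagonalGL (Fin (N - 2 * 1)) K d', hD'U⟩ * κ₂⁻¹ := by
    have h1 : κ₁ * midBlockU hc ⟨q, hqP⟩ * κ₂ = ⟨diagonalGL (Fin (N - 2 * 1)) K d', hD'U⟩ := Subtype.ext hmid
    rw [← h1]; group
  -- the glued diagonal: `λ` on the first slot, `d′` in the middle, `(σλ)⁻¹` on the last (forced by the norm condition)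
  obtain ⟨d, hd⟩ : ∃ d : Fin N → Kˣ, d = fun p => if h0 : p.val < 1 then lamu
      else if h1 : p.val + 1 < N then d' ⟨p.val - 1, by omega⟩ else (Units.map (σ : K →* K) lamu)⁻¹ := ⟨_, rfl⟩
  have hdlo : ∀ i : Fin 1, d (Fin.castLE (le_of_two_mul_le hc) i) = lamu := fun i => by
    rw [hd]; dsimp only; rw [dif_pos (by exact i.isLt)]
  have hdmid : ∀ j : Fin (N - 2 * 1), d (midIndex hc j) = d' j := fun j => by
    have hj := j.isLt
    have h1 : ¬ ((midIndex hc j).val < 1) := by rw [coe_midIndex]; omega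
    have h2 : (midIndex hc j).val + 1 < N := by rw [coe_midIndex]; omega
    rw [hd]; dsimp only; rw [dif_neg h1, dif_pos h2]
    congr 1; apply Fin.ext; change (midIndex hc j).val - 1 = j.val; rw [coe_midIndex]; omega
  have hdhi : ∀ i : Fin 1, d (hiIndex hc i) = (Units.map (σ : K →* K) lamu)⁻¹ := fun i => by
    have hi := i.isLt
    have h1 : ¬ ((hiIndex hc i).val < 1) := by rw [coe_hiIndex]; omega
    have h2 : ¬ ((hiIndex hc i).val + 1 < N) := by rw [coe_hiIndex]; omega
    rw [hd]; dsimp only; rw [dif_neg h1, dif_neg h2]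
  have hdn : ∀ p, σ (d p) * d (Fin.rev p) = 1 := by
    intro p
    obtain ⟨x, rfl⟩ := (blockSum hc).surjective p
    rcases x with (i | i) | i
    · rw [blockSum_inl_inl, rev_castLE hc, hdhi, hdlo, show σ ((lamu : Kˣ) : K) = ((Units.map (σ : K →* K) lamu : Kˣ) : K) from rfl,
        ← Units.val_mul, mul_inv_cancel, Units.val_one]
    · rw [blockSum_inl_inr, rev_midIndex hc, hdmid, hdmid]; exact hd'n i
    · rw [blockSum_inr, rev_hiIndex hc, hdhi, hdlo, Units.val_inv_eq_inv_val,
        show ((Units.map (σ : K →* K) lamu : Kˣ) : K) = σ ((lamu : Kˣ) : K) from rfl, map_inv₀, hσ, inv_mul_cancel₀ (Units.ne_zero _)]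
  have hDU : diagonalGL (Fin N) K d ∈ unitaryGroupOfForm σ ((StdForm.antidiagonal N).over K) := diagonalGL_mem_unitaryGroupOfForm_of_norm hdn
  have hDP : (⟨diagonalGL (Fin N) K d, hDU⟩ : unitaryGroupOfForm σ ((StdForm.antidiagonal N).over K)) ∈ blockParabolic σ N 1 :=
    diagonalGL_mem_blockParabolic hc hdn
  -- the lifts of `κ₁⁻¹`, `κ₂⁻¹`
  have hone : ∀ i j, Valued.v (((1 : GL (Fin 1) K) : Matrix (Fin 1) (Fin 1) K) i j) ≤ 1 := v_one_GL_apply_le_one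
  have hone' : ∀ i j, Valued.v ((((1 : GL (Fin 1) K)⁻¹ : GL (Fin 1) K) : Matrix (Fin 1) (Fin 1) K) i j) ≤ 1 := by rw [inv_one]; exact v_one_GL_apply_le_one
  have hL₁P : blockDiagLift hσ hc 1 κ₁⁻¹ ∈ blockParabolic σ N 1 := blockDiagLift_mem_blockParabolic hσ hc 1 κ₁⁻¹
  have hL₂P : blockDiagLift hσ hc 1 κ₂⁻¹ ∈ blockParabolic σ N 1 := blockDiagLift_mem_blockParabolic hσ hc 1 κ₂⁻¹
  have hL₁K : blockDiagLift hσ hc 1 κ₁⁻¹ ∈ unitaryInt σ ((StdForm.antidiagonal N).over K) :=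
    blockDiagLift_mem_unitaryInt hσ hvσ hc hone hone' (Subgroup.inv_mem _ hκ₁)
  have hL₂K : blockDiagLift hσ hc 1 κ₂⁻¹ ∈ unitaryInt σ ((StdForm.antidiagonal N).over K) :=
    blockDiagLift_mem_unitaryInt hσ hvσ hc hone hone' (Subgroup.inv_mem _ hκ₂)
  -- the product `L₁ D L₂` inside `Q_1`
  have hprodP' : ((((⟨blockDiagLift hσ hc 1 κ₁⁻¹, hL₁P⟩ : blockParabolic σ N 1) * ⟨⟨diagonalGL (Fin N) K d, hDU⟩, hDP⟩ *
      ⟨blockDiagLift hσ hc 1 κ₂⁻¹, hL₂P⟩ : blockParabolic σ N 1) : unitaryGroupOfForm σ ((StdForm.antidiagonal N).over K)) : GL (Fin N) K) ∈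
        standardParabolicGL K (OrderDual.toDual ∘ blockLabel N 1) := by
    rw [Subgroup.coe_mul, Subgroup.coe_mul, Subgroup.coe_mul, Subgroup.coe_mul]
    exact Subgroup.mul_mem _ (Subgroup.mul_mem _ (coe_blockDiagLift_mem_standardParabolicGL_toDual hσ hc 1 κ₁⁻¹)
      (diagonalGL_mem_standardParabolicGL _ d)) (coe_blockDiagLift_mem_standardParabolicGL_toDual hσ hc 1 κ₂⁻¹)
  -- rigidity: `q = L₁ D L₂`
  have heq : q = (((⟨blockDiagLift hσ hc 1 κ₁⁻¹, hL₁P⟩ : blockParabolic σ N 1) * ⟨⟨diagonalGL (Fin N) K d, hDU⟩, hDP⟩ *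
      ⟨blockDiagLift hσ hc 1 κ₂⁻¹, hL₂P⟩ : blockParabolic σ N 1) : unitaryGroupOfForm σ ((StdForm.antidiagonal N).over K)) := by
    refine eq_of_loBlockGL_eq_of_midBlockU_eq hc hqP hqP' (Subtype.prop _) hprodP' ?_ ?_
    · change loBlockGL hc ⟨q, hqP⟩ = loBlockGL hc ((⟨blockDiagLift hσ hc 1 κ₁⁻¹, hL₁P⟩ : blockParabolic σ N 1) *
        ⟨⟨diagonalGL (Fin N) K d, hDU⟩, hDP⟩ * ⟨blockDiagLift hσ hc 1 κ₂⁻¹, hL₂P⟩)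
      rw [map_mul, map_mul, loBlockGL_blockDiagLift, loBlockGL_blockDiagLift, loBlockGL_diagonalGL hc hdn, hlo, one_mul, mul_one,
        show d ∘ Fin.castLE (le_of_two_mul_le hc) = fun _ => lamu from funext hdlo]
    · change midBlockU hc ⟨q, hqP⟩ = midBlockU hc ((⟨blockDiagLift hσ hc 1 κ₁⁻¹, hL₁P⟩ : blockParabolic σ N 1) *
        ⟨⟨diagonalGL (Fin N) K d, hDU⟩, hDP⟩ * ⟨blockDiagLift hσ hc 1 κ₂⁻¹, hL₂P⟩)
      rw [map_mul, map_mul, midBlockU_blockDiagLift, midBlockU_blockDiagLift, hmid']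
      congr 1; congr 1
      refine Subtype.ext (Units.ext ?_)
      rw [coe_midBlockU_diagonalGL hc hdn]
      exact (coe_diagonalGL d').trans (congrArg Matrix.diagonal (funext fun j => by rw [hdmid]))
  -- assemble: `k₁ = L₁⁻¹ ω₁⁻¹ P₁`, `k₂ = P₂ ω₂ L₂⁻¹`
  refine ⟨(blockDiagLift hσ hc 1 κ₁⁻¹)⁻¹ * ω₁⁻¹ * P₁, P₂ * ω₂ * (blockDiagLift hσ hc 1 κ₂⁻¹)⁻¹,
    Subgroup.mul_mem _ (Subgroup.mul_mem _ (Subgroup.inv_mem _ hL₁K) (Subgroup.inv_mem _ hω₁)) hP₁K,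
    Subgroup.mul_mem _ (Subgroup.mul_mem _ hP₂K hω₂) (Subgroup.inv_mem _ hL₂K), d, hdn, ?_⟩
  have hU : (blockDiagLift hσ hc 1 κ₁⁻¹)⁻¹ * ω₁⁻¹ * P₁ * g * (P₂ * ω₂ * (blockDiagLift hσ hc 1 κ₂⁻¹)⁻¹) =
      (⟨diagonalGL (Fin N) K d, hDU⟩ : unitaryGroupOfForm σ ((StdForm.antidiagonal N).over K)) := by
    have h1 : ω₁⁻¹ * (P₁ * g * P₂) * ω₂ = blockDiagLift hσ hc 1 κ₁⁻¹ * ⟨diagonalGL (Fin N) K d, hDU⟩ * blockDiagLift hσ hc 1 κ₂⁻¹ := by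
      have h := heq
      rw [hq, hg₁] at h
      rw [h, Subgroup.coe_mul, Subgroup.coe_mul]
    calc (blockDiagLift hσ hc 1 κ₁⁻¹)⁻¹ * ω₁⁻¹ * P₁ * g * (P₂ * ω₂ * (blockDiagLift hσ hc 1 κ₂⁻¹)⁻¹)
        = (blockDiagLift hσ hc 1 κ₁⁻¹)⁻¹ * (ω₁⁻¹ * (P₁ * g * P₂) * ω₂) * (blockDiagLift hσ hc 1 κ₂⁻¹)⁻¹ := by group
      _ = (blockDiagLift hσ hc 1 κ₁⁻¹)⁻¹ * (blockDiagLift hσ hc 1 κ₁⁻¹ * ⟨diagonalGL (Fin N) K d, hDU⟩ * blockDiagLift hσ hc 1 κ₂⁻¹) *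
            (blockDiagLift hσ hc 1 κ₂⁻¹)⁻¹ := by rw [h1]
      _ = ⟨diagonalGL (Fin N) K d, hDU⟩ := by group
  have := congrArg (fun x : unitaryGroupOfForm σ ((StdForm.antidiagonal N).over K) => (x : GL (Fin N) K)) hU
  simpa only using this

/-- **CARTAN DECOMPOSITION OF `U(σ, J₀)(K)` FOR ANY ISOMETRIC INVOLUTION `σ`** (`K` any field with a valuation `v : K → ℤᵐ⁰`, `v ∘ σ = v`): every `g ∈ U(σ, J₀)` is
`k₁⁻¹ · diag(d) · k₂⁻¹` with `k₁, k₂ ∈ K₀ = U ∩ GL_N(𝒪)` and `σ(d_i) · d_{rev i} = 1` — strong induction on `N`: an integral `g` is in `K₀`; otherwise a maximal entry of `g`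
or of `g⁻¹` sits at a position `(s, t)` with `s ≠ rev s`, `t ≠ rev t` (part I §2), and `exists_unitaryInt_mul_mul_eq_diagonalGL_of_pivot` applies (to `g⁻¹`, then invert).
[cite: BruhatTits1972, (4.4.3)] [cite: Tits1979, §3.3.3] [cite: Macdonald1995, Ch. V §2] -/
theorem exists_unitaryInt_mul_mul_eq_diagonalGL (hσ : ∀ x, σ (σ x) = x) (hvσ : ∀ x, Valued.v (σ x) = Valued.v x) :
    ∀ (N : ℕ) (g : unitaryGroupOfForm σ ((StdForm.antidiagonal N).over K)),
      ∃ k₁ k₂ : unitaryGroupOfForm σ ((StdForm.antidiagonal N).over K),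
        k₁ ∈ unitaryInt σ ((StdForm.antidiagonal N).over K) ∧ k₂ ∈ unitaryInt σ ((StdForm.antidiagonal N).over K) ∧
        ∃ d : Fin N → Kˣ, (∀ i, σ (d i) * d (Fin.rev i) = 1) ∧
          ((k₁ * g * k₂ : unitaryGroupOfForm σ ((StdForm.antidiagonal N).over K)) : GL (Fin N) K) = diagonalGL (Fin N) K d := by
  intro N
  induction N using Nat.strong_induction_on with
  | _ N IH =>
  intro g
  by_cases hint : ∀ i j, Valued.v (((g : GL (Fin N) K) : Matrix (Fin N) (Fin N) K) i j) ≤ 1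
  · -- `g ∈ K₀`
    have hgK : g ∈ unitaryInt σ ((StdForm.antidiagonal N).over K) := (mem_unitaryInt_iff_forall_v_le_one hvσ).2 hint
    refine ⟨g⁻¹, 1, Subgroup.inv_mem _ hgK, Subgroup.one_mem _, 1, fun i => by rw [Pi.one_apply, Pi.one_apply, Units.val_one, map_one, mul_one], ?_⟩
    rw [inv_mul_cancel, one_mul, OneMemClass.coe_one, map_one]
  · push Not at hint
    obtain ⟨i₁, j₁, hij₁⟩ := hint
    have hne : (Finset.univ : Finset (Fin N × Fin N)).Nonempty := ⟨(i₁, j₁), Finset.mem_univ _⟩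
    obtain ⟨⟨s₁, t₁⟩, -, hmax⟩ := Finset.exists_max_image Finset.univ
      (fun p : Fin N × Fin N => Valued.v (((g : GL (Fin N) K) : Matrix (Fin N) (Fin N) K) p.1 p.2)) hne
    set M : ℤᵐ⁰ := Valued.v (((g : GL (Fin N) K) : Matrix (Fin N) (Fin N) K) s₁ t₁) with hM
    have hle : ∀ i j, Valued.v (((g : GL (Fin N) K) : Matrix (Fin N) (Fin N) K) i j) ≤ M := fun i j => hmax (i, j) (Finset.mem_univ _)
    have hM1 : 1 < M := lt_of_lt_of_le hij₁ (hle i₁ j₁)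
    have hM0 : M ≠ 0 := ne_of_gt (lt_trans zero_lt_one hM1)
    have IH' := IH (N - 2 * 1)
    by_cases ht₁ : t₁ = Fin.rev t₁
    · -- the maximal entry sits in the middle column: pass to `g⁻¹`
      obtain ⟨s', hs', hs'M⟩ := exists_pivot_row hvσ g t₁ hM0 (fun i => hle i t₁) ⟨s₁, rfl⟩ (Or.inr hM1)
      have hN2 : 2 ≤ N := by
        have h1 := s'.isLt; have h2 : (s' : ℕ) ≠ N - 1 - (s' : ℕ) := fun h => hs' (Fin.ext (by rw [Fin.val_rev]; omega)); omega
      have hinv_le : ∀ i j, Valued.v ((((g⁻¹ : unitaryGroupOfForm σ ((StdForm.antidiagonal N).over K)) : GL (Fin N) K) : Matrix (Fin N) (Fin N) K) i j) ≤ M :=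
        fun i j => by rw [coe_inv_apply_unitary, hvσ]; exact hle _ _
      have hinv_entry : Valued.v ((((g⁻¹ : unitaryGroupOfForm σ ((StdForm.antidiagonal N).over K)) : GL (Fin N) K) : Matrix (Fin N) (Fin N) K)
          (Fin.rev t₁) (Fin.rev s')) = M := by
        rw [coe_inv_apply_unitary, hvσ, Fin.rev_rev, Fin.rev_rev]; exact hs'M
      have hcol : Fin.rev s' ≠ Fin.rev (Fin.rev s') := by rw [Fin.rev_rev]; exact Ne.symm hs'
      obtain ⟨s, hs, hsM⟩ := exists_pivot_row hvσ g⁻¹ (Fin.rev s') hM0 (fun i => hinv_le i _) ⟨Fin.rev t₁, hinv_entry⟩ (Or.inl hcol)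
      obtain ⟨k₁, k₂, hk₁, hk₂, d, hdn, heq⟩ :=
        exists_unitaryInt_mul_mul_eq_diagonalGL_of_pivot hσ hvσ (IH (N - 2 * 1) (by omega)) g⁻¹ hM0 hinv_le hs hcol hsM
      refine ⟨k₂⁻¹, k₁⁻¹, Subgroup.inv_mem _ hk₂, Subgroup.inv_mem _ hk₁, d⁻¹, fun i => ?_, ?_⟩
      · rw [Pi.inv_apply, Pi.inv_apply, Units.val_inv_eq_inv_val, Units.val_inv_eq_inv_val, map_inv₀, ← mul_inv, hdn i, inv_one]
      · have h : ((k₁ * g⁻¹ * k₂ : unitaryGroupOfForm σ ((StdForm.antidiagonal N).over K)) : GL (Fin N) K)⁻¹ = diagonalGL (Fin N) K d⁻¹ := by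
          rw [heq, map_inv]
        rw [← h, Subgroup.coe_mul, Subgroup.coe_mul, Subgroup.coe_mul, Subgroup.coe_mul, Subgroup.coe_inv, Subgroup.coe_inv, Subgroup.coe_inv]
        group
    · -- the maximal entry sits in a non-middle column: pivot row for `g`
      obtain ⟨s, hs, hsM⟩ := exists_pivot_row hvσ g t₁ hM0 (fun i => hle i t₁) ⟨s₁, rfl⟩ (Or.inl ht₁)
      have hN2 : 2 ≤ N := by
        have h1 := s.isLt; have h2 : (s : ℕ) ≠ N - 1 - (s : ℕ) := fun h => hs (Fin.ext (by rw [Fin.val_rev]; omega)); omega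
      exact exists_unitaryInt_mul_mul_eq_diagonalGL_of_pivot hσ hvσ (IH (N - 2 * 1) (by omega)) g hM0 hle hs ht₁ hsM

/-- **THE CARTAN DECOMPOSITION `U(σ, J₀)(K) = K₀ · T · K₀` FOR ANY ISOMETRIC INVOLUTION — in the shape of ★ `exists_cartan_antidiagonal_of_trace_norm` (K2E3-p23) WITHOUT
the hypotheses `(hϖ) (htrace) (hnorm)`**: for `g ∈ U(σ, J₀)`, `k₁ g k₂ = diag(d)` with `k₁, k₂ ∈ U(σ, J₀)` integral with integral inverses and `σ(d_i) · d_{rev i} = 1`.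
No uniformiser, no (trace), no (norm), no `2 ≠ 0`: the wildly ramified quadratic extensions are included. [cite: BruhatTits1972, (4.4.3)] [cite: Tits1979, §3.3.3]
[cite: Jacobowitz1962, §§7–10] -/
theorem exists_cartan_antidiagonal (hσ : ∀ x, σ (σ x) = x) (hvσ : ∀ x, Valued.v (σ x) = Valued.v x) {N : ℕ} (g : GL (Fin N) K)
    (hg : g ∈ unitaryGroupOfForm σ ((StdForm.antidiagonal N).over K)) :
    ∃ k₁ k₂ : GL (Fin N) K,
      k₁ ∈ unitaryGroupOfForm σ ((StdForm.antidiagonal N).over K) ∧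
      (∀ i j, Valued.v ((k₁ : Matrix (Fin N) (Fin N) K) i j) ≤ 1) ∧
      (∀ i j, Valued.v (((k₁⁻¹ : GL (Fin N) K) : Matrix (Fin N) (Fin N) K) i j) ≤ 1) ∧
      k₂ ∈ unitaryGroupOfForm σ ((StdForm.antidiagonal N).over K) ∧
      (∀ i j, Valued.v ((k₂ : Matrix (Fin N) (Fin N) K) i j) ≤ 1) ∧
      (∀ i j, Valued.v (((k₂⁻¹ : GL (Fin N) K) : Matrix (Fin N) (Fin N) K) i j) ≤ 1) ∧
      ∃ d : Fin N → K, ((k₁ * g * k₂ : GL (Fin N) K) : Matrix (Fin N) (Fin N) K) = Matrix.diagonal d ∧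
        ∀ i, σ (d i) * d (Fin.rev i) = 1 := by
  obtain ⟨k₁, k₂, hk₁, hk₂, d, hdn, heq⟩ := exists_unitaryInt_mul_mul_eq_diagonalGL hσ hvσ N ⟨g, hg⟩
  refine ⟨(k₁ : GL (Fin N) K), (k₂ : GL (Fin N) K), k₁.2, (mem_unitaryInt_iff.1 hk₁).1, (mem_unitaryInt_iff.1 hk₁).2, k₂.2,
    (mem_unitaryInt_iff.1 hk₂).1, (mem_unitaryInt_iff.1 hk₂).2, fun i => (d i : K), ?_, hdn⟩
  have h : ((k₁ : GL (Fin N) K) * g * (k₂ : GL (Fin N) K)) = diagonalGL (Fin N) K d := by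
    rw [← heq, Subgroup.coe_mul, Subgroup.coe_mul]
  rw [h, coe_diagonalGL]

end Main

end Summit.HodgeConjecture.HodgeConjecture.Cruxes.H413.K2E3QuasiSplitUnitaryCartanAnyInvolution

end
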